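import Mathlib
import Summits.NavierStokesRegularity.NavierStokesRegularity.Theorems.EulerZoomLiouvillePowerGaugeEulerLiouvilleSelfSimilarBernoulliSqueezeSobolevGrowthTools
import Summits.NavierStokesRegularity.NavierStokesRegularity.Theorems.EulerZoomLiouvillePowerGaugeEulerLiouvilleSelfSimilarBernoulliSqueezePressureThinTools
import HarnessLib

/-!
# «SUPER-FAST CHANNELS SQUEEZE VOLUME TOO FAST», past half: THE PRESSURE-HIGH SET IS SOBOLEV-THIN FROM GROWTH-FORM DATA (rate `m = 3+3ρ`)
# (crux `EulerZoomLiouville.PowerGaugeEulerLiouville` = stmt-NavierStokesRegularity-19832, line `birth`, THE ONE STATEMENT and its past stratum)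

Route №10 `EulerZoomLiouville` (NavierStokesRegularity); width seat ns-ezl-w5 g2.  With the tools of `…SqueezeSobolevGrowthTools` (this seat) and the scalar GNS
lemma `Loc.lintegral_pow_six_le_of_cutoff_real` of `…SqueezePressureThinTools` (LEAD ns-typeII-p2 g12, p639114):

THE BRICK.  `(U, P)` a CIV (3.3) profile (any exponent `γ`, centre `0`) of LINEAR GROWTH `‖U y‖ ≤ K₁(1+‖y‖)` with the class growths
`∫_{B_L}|U|² ≤ c_A L^{1−2ρ}`, `∫_{B_L}‖∇U‖² ≤ c_E L^{1−ρ}` (`L > 0`) and a measurable `Q = P + c₀` a.e. carrying the GROWTH-FORM `D`-datum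
`∫_{B_R}|Q|^{3/2} ≤ C_D R^{2−2ρ}` for `R ≥ L₁` (`−2 ≤ ρ`; this is what the PAST dictionary gives: `Shifted.profile_energy_growth_of_gaugeA_past` +
`Shifted.growth_of_growth_le`, `NeedleRace.lintegral_fderiv_sq_ball_le_of_past` + `Loc.real_growth_of_growth_le`, `Past.profile_pressure_growth_of_gaugeD_past`,
bridge `WeakToClassical.pressureProfile_ae_eq_add_const` on the far-past extension).  Then for every `ε > 0`

> `vol({ε‖y‖² < P y} ∩ {L ≤ ‖y‖ ≤ 2L}) ≤ K L^{−3−3ρ}` for `L ≥ L₀` (`Loc.volume_pressureHigh_inter_shell_le_sobolev_of_growth`),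
> `vol({ε‖y‖² < P y} ∩ {R ≤ ‖y‖}) ≤ K′ R^{−3−3ρ}` for `R ≥ L₀` (`Loc.volume_pressureHigh_inter_far_le_sobolev_of_growth`).

PROOF.  GNS (`p = 2`, `p* = 6`) for the `C¹` compactly supported truncation `f = χ_L · ψ(P/(εL²))` (`χ_L` the LEAD's scaled cutoff, `= 1` on `‖y‖ ≤ 2L`,
`‖∇χ_L‖ ≤ M/L`; `ψ` the unit smooth step): `f = 1` on the target set, so its volume is `≤ ∫f⁶ ≤ C_GNS⁶(∫‖∇f‖²)³`, and
`∫‖∇f‖² ≤ 2(κ/(εL²))²∫_{B_{5L}}‖∇P‖² + 2(M/L)²·vol({P > εL²/2} ∩ B_{5L})`.  The gradient budget is `≲ L^{3−ρ}` (profile equation + linear growth + `A`/`E`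
growths), the support volume is `≲ L^{−1−2ρ}` (growth-form Chebyshev for `Q` on `B_{5L}` at height `εL²/4 ≥ εL²/2 − |c₀|`), so `∫‖∇f‖² ≲ L^{−1−ρ}` and the
volume is `≲ L^{−3−3ρ}`.  The ORIGIN-centred twin with the weighted whole-space `D`-datum is the LEAD's `Loc.volume_pressureHigh_inter_closedBall_le_sobolev`
(p639126); the growth form is strictly weaker as an input (log-divergent dyadic sum), which is why the past stratum needs this file.

CONSEQUENCE (`…SqueezeSobolevSharpPast`): the past / shifted sharp channel stratum (skeleton v59, `IsPastSelfSimilarClassical` disjunct 4) drops its threshold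
from `3/((2+ρ)(1+2ρ))` to `1/((2+ρ)(1+ρ))`, in step with the origin-centred `HasFastVorticalChannel`.
HONEST LABEL: a brick for ONE dynamical sub-stratum (past form) of THE ONE STATEMENT.  WHAT THIS IS NOT: not NS, not E — 19832 is a crux CLASS on the MODEL
lattice (E/NS strata) and stays OPEN; NS regularity is NOT proved. [folklore; ConstantinIgnatovaVicol2026Putative §3.1.1 (3.3), §3.4.3 (3.30); GNS inequality]
-/

noncomputable section

-- flat `Theorems/<Route><Decl>…` files of one crux share the namespace of the crux (tree convention)
set_option linter.dupNamespace false

open MeasureTheory Set Filter Topology Metric Function InnerProductSpace Module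
open scoped RealInnerProductSpace NNReal ENNReal ContDiff

namespace Summit.NavierStokesRegularity.NavierStokesRegularity.Theorems.PowerGaugeEulerLiouville.Loc

open Literature.Analysis Literature.Analysis.FluidPDE

variable {γ : ℝ} {U : EuclideanSpace ℝ (Fin 3) → EuclideanSpace ℝ (Fin 3)} {P : EuclideanSpace ℝ (Fin 3) → ℝ}

/-! ### The pressure-high set is Sobolev-thin, growth-form data -/

set_option maxHeartbeats 800000 in
/-- **THE PRESSURE-HIGH SET IS SOBOLEV-THIN ON DYADIC SHELLS — growth-form data.**  `(U, P)` a CIV (3.3) profile (any exponent `γ`, centre `0`) of linear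
growth `‖U y‖ ≤ K₁(1+‖y‖)` with the class growths `∫_{B_L}|U|² ≤ c_A L^{1−2ρ}`, `∫_{B_L}‖∇U‖² ≤ c_E L^{1−ρ}` (`L > 0`), and a measurable `Q = P + c₀` a.e. with the
GROWTH-FORM `D`-datum `∫_{B_R}|Q|^{3/2} ≤ C_D R^{2−2ρ}` for `R ≥ L₁`; `−2 ≤ ρ`, `ε > 0`.  Then there are `K ≥ 0`, `L₀ ≥ max 1 L₁` with
`vol({ε‖y‖² < P y} ∩ {L ≤ ‖y‖ ≤ 2L}) ≤ K L^{−3−3ρ}` for all `L ≥ L₀` (GNS on the truncation `χ_L · ψ(P/(εL²))`: gradient term from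
`Loc.lintegral_fderiv_profilePressure_sq_le`, support term from `Loc.volume_absPressureHigh_inter_ball_le_of_growth`; the LEAD's origin-centred
`Loc.volume_pressureHigh_inter_closedBall_le_sobolev` (p639126) is the weighted-datum twin). [folklore; Gagliardo–Nirenberg–Sobolev inequality] -/
theorem volume_pressureHigh_inter_shell_le_sobolev_of_growth {ρ : ℝ} (hρ0 : -2 ≤ ρ)
    (hprof : IsSelfSimilarEulerProfile γ 0 U P)
    {K₁ : ℝ} (hK₁ : ∀ y : EuclideanSpace ℝ (Fin 3), ‖U y‖ ≤ K₁ * (1 + ‖y‖))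
    {cA cE : ℝ} (hcA : 0 ≤ cA) (hcE : 0 ≤ cE)
    (hA : ∀ L : ℝ, 0 < L → ∫⁻ y in ball (0 : EuclideanSpace ℝ (Fin 3)) L, ‖U y‖ₑ ^ 2 ≤ ENNReal.ofReal (cA * L ^ (1 - 2 * ρ)))
    (hE : ∀ L : ℝ, 0 < L → ∫⁻ y in ball (0 : EuclideanSpace ℝ (Fin 3)) L, ‖fderiv ℝ U y‖ₑ ^ 2 ≤
      ENNReal.ofReal (cE * L ^ (1 - ρ)))
    {Q : EuclideanSpace ℝ (Fin 3) → ℝ} (hQm : AEStronglyMeasurable Q volume) {CD : ℝ≥0} {L₁ : ℝ}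
    (hD : ∀ R : ℝ, L₁ ≤ R → ∫⁻ y in ball (0 : EuclideanSpace ℝ (Fin 3)) R, ‖Q y‖ₑ ^ (3 / 2 : ℝ) ≤
      CD * ENNReal.ofReal (R ^ (2 - 2 * ρ)))
    {c₀ : ℝ} (hc₀ : Q =ᵐ[volume] fun y => P y + c₀) {ε : ℝ} (hε : 0 < ε) :
    ∃ K L₀ : ℝ, 0 ≤ K ∧ max 1 L₁ ≤ L₀ ∧ ∀ L : ℝ, L₀ ≤ L →
      volume ({y : EuclideanSpace ℝ (Fin 3) | ε * ‖y‖ ^ 2 < P y} ∩ {y | L ≤ ‖y‖ ∧ ‖y‖ ≤ 2 * L}) ≤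
        ENNReal.ofReal (K * L ^ (-3 - 3 * ρ)) := by
  obtain ⟨M, hM0, hcut⟩ := exists_scaledCutoff
  obtain ⟨κ, hκ0, ψ, hψ1, hψ0, hψle, hψzero, hψone, hdψ⟩ := exists_unitSmoothStep
  have hK₁0 : 0 ≤ K₁ := by
    have := hK₁ 0; simp at this; exact (norm_nonneg _).trans this
  have hPc : ContDiff ℝ 1 P := hprof.contDiff_pressure
  have hPcont : Continuous P := hPc.continuous
  have hCD0 : (0 : ℝ) ≤ CD := NNReal.coe_nonneg CD
  set Cr : ℝ := ((eLpNormLESNormFDerivOfEqInnerConst (volume : Measure (EuclideanSpace ℝ (Fin 3))) 2 : ℝ≥0) : ℝ) with hCr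
  have hCr0 : 0 ≤ Cr := NNReal.coe_nonneg _
  -- ### the constants
  set K₂ : ℝ := 5 * |γ| + 6 * K₁ with hK₂
  have hK₂0 : 0 ≤ K₂ := by positivity
  set G₁ : ℝ := 2 * (1 - γ) ^ 2 * (cA * 5 ^ (1 - 2 * ρ)) + 2 * K₂ ^ 2 * (cE * 5 ^ (1 - ρ)) with hG₁
  have hG₁0 : 0 ≤ G₁ := by positivity
  have hε4 : 0 < (ε / 4) ^ (3 / 2 : ℝ) := Real.rpow_pos_of_pos (by positivity) _
  set N₁ : ℝ := (CD : ℝ) * (5 : ℝ) ^ (2 - 2 * ρ) * ((ε / 4) ^ (3 / 2 : ℝ))⁻¹ with hN₁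
  have hN₁0 : 0 ≤ N₁ := by positivity
  set KX : ℝ := 2 * (κ ^ 2 / ε ^ 2 * G₁) + 2 * (M ^ 2 * N₁) with hKX
  have hKX0 : 0 ≤ KX := by positivity
  -- ### the threshold: `L ≥ 1` and `ε L² / 4 ≥ |c₀|`
  set L₀ : ℝ := max (max 1 L₁) (2 * Real.sqrt (|c₀| / ε)) with hL₀
  refine ⟨Cr ^ 6 * KX ^ 3, L₀, by positivity, le_max_left _ _, fun L hL => ?_⟩
  have hL1 : 1 ≤ L := ((le_max_left _ _).trans (le_max_left _ _)).trans hL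
  have hLL₁ : L₁ ≤ 5 * L := by
    have h1 : L₁ ≤ L := ((le_max_right _ _).trans (le_max_left _ _)).trans hL
    linarith
  have hL0 : 0 < L := one_pos.trans_le hL1
  have h5L : 0 < 5 * L := by positivity
  have hc₀L : |c₀| ≤ ε * L ^ 2 / 4 := by
    have h1 : 2 * Real.sqrt (|c₀| / ε) ≤ L := (le_max_right _ _).trans hL
    have h2 : 0 ≤ Real.sqrt (|c₀| / ε) := Real.sqrt_nonneg _
    have h3 : Real.sqrt (|c₀| / ε) ^ 2 = |c₀| / ε := Real.sq_sqrt (by positivity)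
    have h4 : 4 * (|c₀| / ε) ≤ L ^ 2 := by nlinarith
    have h5 : |c₀| / ε ≤ L ^ 2 / 4 := by linarith
    rw [div_le_iff₀ hε] at h5
    linarith
  -- ### the inputs at this scale (before abbreviating)
  have hIgradP := lintegral_fderiv_profilePressure_sq_le hprof hK₁ hL1
  have hE' := hE (5 * L) h5L
  have hA' := hA (5 * L) h5L
  -- ### the cutoff and the truncation
  obtain ⟨χ, hχ1, hχc, h0, h1, hone, hzero, hdχ⟩ := hcut L hL0
  set s : ℝ := ε * L ^ 2 with hs
  have hs0 : 0 < s := by positivity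
  have hcheb := volume_absPressureHigh_inter_ball_le_of_growth (ρ := ρ) hQm hD (by positivity : 0 < s / 4) hLL₁
  set g : EuclideanSpace ℝ (Fin 3) → ℝ := fun y => ψ (s⁻¹ • P y) with hg
  have hPs : ContDiff ℝ 1 (fun y => s⁻¹ • P y) := hPc.const_smul s⁻¹
  have hg1 : ContDiff ℝ 1 g := hψ1.comp hPs
  have hg_one : ∀ y : EuclideanSpace ℝ (Fin 3), L ≤ ‖y‖ → ε * ‖y‖ ^ 2 < P y → g y = 1 := by
    intro y hyL hyP
    apply hψone
    have h2 : ε * L ^ 2 ≤ ε * ‖y‖ ^ 2 := mul_le_mul_of_nonneg_left (pow_le_pow_left₀ hL0.le hyL 2) hε.le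
    rw [smul_eq_mul, inv_mul_eq_div, le_div_iff₀ hs0, one_mul]
    linarith
  have hg_supp : ∀ y : EuclideanSpace ℝ (Fin 3), g y ≠ 0 → s / 2 < P y := by
    intro y hy
    by_contra hle
    push Not at hle
    refine hy (hψzero _ ?_)
    rw [smul_eq_mul, inv_mul_eq_div, div_le_iff₀ hs0]
    linarith
  -- pointwise gradient bound for the truncation
  have hgd_pt : ∀ y : EuclideanSpace ℝ (Fin 3), ‖fderiv ℝ g y‖ ≤ κ * s⁻¹ * ‖fderiv ℝ P y‖ := by
    intro y
    have hd1 : HasFDerivAt P (fderiv ℝ P y) y := (hPc.differentiable one_ne_zero y).hasFDerivAt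
    have hd2 : HasFDerivAt (fun y => s⁻¹ • P y) (s⁻¹ • fderiv ℝ P y) y := hd1.const_smul s⁻¹
    have hd3 : HasFDerivAt ψ (fderiv ℝ ψ (s⁻¹ • P y)) (s⁻¹ • P y) :=
      (hψ1.differentiable one_ne_zero _).hasFDerivAt
    have hd4 : HasFDerivAt g ((fderiv ℝ ψ (s⁻¹ • P y)).comp (s⁻¹ • fderiv ℝ P y)) y := hd3.comp y hd2
    rw [hd4.fderiv]
    calc ‖(fderiv ℝ ψ (s⁻¹ • P y)).comp (s⁻¹ • fderiv ℝ P y)‖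
        ≤ ‖fderiv ℝ ψ (s⁻¹ • P y)‖ * ‖s⁻¹ • fderiv ℝ P y‖ := ContinuousLinearMap.opNorm_comp_le _ _
      _ ≤ κ * (s⁻¹ * ‖fderiv ℝ P y‖) := by
          rw [norm_smul, Real.norm_of_nonneg (inv_nonneg.2 hs0.le)]
          exact mul_le_mul_of_nonneg_right (hdψ _) (by positivity)
      _ = κ * s⁻¹ * ‖fderiv ℝ P y‖ := by ring
  -- ### GNS
  have hI6 := lintegral_pow_six_le_of_cutoff_real hg1 hχ1 hχc h1 h0 hL0 hone hzero hdχ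
  -- ### the left-hand side dominates the volume of the target set
  set T : Set (EuclideanSpace ℝ (Fin 3)) := {y | ε * ‖y‖ ^ 2 < P y} ∩ {y | L ≤ ‖y‖ ∧ ‖y‖ ≤ 2 * L} with hT
  have hTmeas : MeasurableSet T :=
    (isOpen_lt (continuous_const.mul (continuous_norm.pow 2)) hPcont).measurableSet.inter
      ((isClosed_le continuous_const continuous_norm).inter (isClosed_le continuous_norm continuous_const)).measurableSet
  have hvolT : volume T ≤ ∫⁻ y in closedBall (0 : EuclideanSpace ℝ (Fin 3)) (2 * L), ‖g y‖ₑ ^ 6 := by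
    calc volume T = ∫⁻ _ in T, 1 := (setLIntegral_one T).symm
      _ = ∫⁻ y in T, ‖g y‖ₑ ^ 6 := by
          refine setLIntegral_congr_fun hTmeas (fun y hy => ?_)
          obtain ⟨hyP, hyL, -⟩ := hy
          rw [hg_one y hyL hyP]
          simp
      _ ≤ ∫⁻ y in closedBall (0 : EuclideanSpace ℝ (Fin 3)) (2 * L), ‖g y‖ₑ ^ 6 := by
          refine lintegral_mono_set fun y hy => ?_
          rw [mem_closedBall, dist_zero_right]
          exact hy.2.2
  -- ### the gradient term
  have hIgradg : ∫⁻ y in ball (0 : EuclideanSpace ℝ (Fin 3)) (5 * L), ‖fderiv ℝ g y‖ₑ ^ 2 ≤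
      ENNReal.ofReal ((κ * s⁻¹) ^ 2) * ∫⁻ y in ball (0 : EuclideanSpace ℝ (Fin 3)) (5 * L), ‖fderiv ℝ P y‖ₑ ^ 2 := by
    rw [← lintegral_const_mul' _ _ ENNReal.ofReal_ne_top]
    refine lintegral_mono fun y => ?_
    rw [← ofReal_norm, ← ENNReal.ofReal_pow (norm_nonneg _), ← ofReal_norm, ← ENNReal.ofReal_pow (norm_nonneg _),
      ← ENNReal.ofReal_mul (sq_nonneg _), ← mul_pow]
    exact ENNReal.ofReal_le_ofReal (pow_le_pow_left₀ (norm_nonneg _) (hgd_pt y) 2)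
  -- ### the support term
  set S₁ : Set (EuclideanSpace ℝ (Fin 3)) := {y | s / 2 < P y} with hS₁
  have hS₁m : MeasurableSet S₁ := (isOpen_lt continuous_const hPcont).measurableSet
  have hIg2 : ∫⁻ y in ball (0 : EuclideanSpace ℝ (Fin 3)) (5 * L), ‖g y‖ₑ ^ 2 ≤
      volume (S₁ ∩ ball (0 : EuclideanSpace ℝ (Fin 3)) (5 * L)) := by
    calc ∫⁻ y in ball (0 : EuclideanSpace ℝ (Fin 3)) (5 * L), ‖g y‖ₑ ^ 2
        ≤ ∫⁻ y in ball (0 : EuclideanSpace ℝ (Fin 3)) (5 * L), S₁.indicator 1 y := by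
          refine lintegral_mono fun y => ?_
          by_cases hy : y ∈ S₁
          · rw [indicator_of_mem hy, Pi.one_apply, ← ofReal_norm, ← ENNReal.ofReal_pow (norm_nonneg _)]
            refine ENNReal.ofReal_le_one.2 ?_
            rw [Real.norm_of_nonneg (hψ0 _)]
            exact pow_le_one₀ (hψ0 _) (hψle _)
          · have hgy : g y = 0 := by
              by_contra hne
              exact hy (hg_supp y hne)
            rw [hgy]
            simp
      _ = volume (S₁ ∩ ball (0 : EuclideanSpace ℝ (Fin 3)) (5 * L)) := by
          rw [lintegral_indicator_one hS₁m, Measure.restrict_apply hS₁m]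
  have hS₁S₂ : volume (S₁ ∩ ball (0 : EuclideanSpace ℝ (Fin 3)) (5 * L)) ≤
      volume ({y : EuclideanSpace ℝ (Fin 3) | s / 4 ≤ ‖Q y‖} ∩ ball (0 : EuclideanSpace ℝ (Fin 3)) (5 * L)) := by
    refine measure_mono_ae ?_
    filter_upwards [hc₀] with y hy
    rintro ⟨hyS, hyB⟩
    refine ⟨?_, hyB⟩
    have hyS' : s / 2 < P y := hyS
    show s / 4 ≤ ‖Q y‖
    rw [hy, Real.norm_eq_abs]
    have hc : -(s / 4) ≤ c₀ := by
      have hs4 : |c₀| ≤ s / 4 := by rw [hs]; exact hc₀L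
      linarith [neg_abs_le c₀]
    exact le_trans (by linarith) (le_abs_self _)
  -- ### abbreviations and the assembled `ℝ≥0∞` bound
  set A' : ℝ := cA * (5 * L) ^ (1 - 2 * ρ) with hA'def
  set E' : ℝ := cE * (5 * L) ^ (1 - ρ) with hE'def
  set w : ℝ := (K₂ * L) ^ 2 with hw
  set G : ℝ := 2 * (1 - γ) ^ 2 * A' + 2 * w * E' with hGdef
  set q : ℝ := (κ * s⁻¹) ^ 2 with hq
  set N' : ℝ := (CD : ℝ) * (5 * L) ^ (2 - 2 * ρ) / (s / 4) ^ (3 / 2 : ℝ) with hN'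
  set m2 : ℝ := (M / L) ^ 2 with hm2
  set X : ℝ := 2 * (q * G) + 2 * m2 * N' with hX
  have hA'0 : 0 ≤ A' := by positivity
  have hE'0 : 0 ≤ E' := by positivity
  have hw0 : 0 ≤ w := by positivity
  have hG0 : 0 ≤ G := by positivity
  have hq0 : 0 ≤ q := by positivity
  have hs4pos : 0 < (s / 4) ^ (3 / 2 : ℝ) := Real.rpow_pos_of_pos (by positivity) _
  have hN'0 : 0 ≤ N' := div_nonneg (mul_nonneg hCD0 (Real.rpow_nonneg h5L.le _)) hs4pos.le
  have hm20 : 0 ≤ m2 := by positivity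
  have hX0 : 0 ≤ X := by positivity
  have hofG : ENNReal.ofReal G =
      2 * ENNReal.ofReal ((1 - γ) ^ 2) * ENNReal.ofReal A' + 2 * ENNReal.ofReal w * ENNReal.ofReal E' := by
    rw [hGdef, ENNReal.ofReal_add (by positivity) (by positivity),
      ENNReal.ofReal_mul (by positivity : (0 : ℝ) ≤ 2 * (1 - γ) ^ 2), ENNReal.ofReal_mul (by norm_num : (0 : ℝ) ≤ 2),
      ENNReal.ofReal_mul (by positivity : (0 : ℝ) ≤ 2 * w), ENNReal.ofReal_mul (by norm_num : (0 : ℝ) ≤ 2),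
      ENNReal.ofReal_ofNat]
  have hIgradP' : ∫⁻ y in ball (0 : EuclideanSpace ℝ (Fin 3)) (5 * L), ‖fderiv ℝ P y‖ₑ ^ 2 ≤ ENNReal.ofReal G := by
    refine hIgradP.trans ?_
    rw [hofG]
    gcongr
  have hIgradg' : ∫⁻ y in ball (0 : EuclideanSpace ℝ (Fin 3)) (5 * L), ‖fderiv ℝ g y‖ₑ ^ 2 ≤ ENNReal.ofReal (q * G) := by
    rw [ENNReal.ofReal_mul hq0]
    exact hIgradg.trans (by gcongr)
  have hIg2' : ∫⁻ y in ball (0 : EuclideanSpace ℝ (Fin 3)) (5 * L), ‖g y‖ₑ ^ 2 ≤ ENNReal.ofReal N' :=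
    hIg2.trans (hS₁S₂.trans hcheb)
  have hofX : ENNReal.ofReal X = 2 * ENNReal.ofReal (q * G) + 2 * ENNReal.ofReal m2 * ENNReal.ofReal N' := by
    rw [hX, ENNReal.ofReal_add (by positivity) (by positivity), ENNReal.ofReal_mul (by norm_num : (0 : ℝ) ≤ 2),
      ENNReal.ofReal_mul (by positivity : (0 : ℝ) ≤ 2 * m2), ENNReal.ofReal_mul (by norm_num : (0 : ℝ) ≤ 2),
      ENNReal.ofReal_ofNat]
  have hmain : volume T ≤ ENNReal.ofReal (Cr ^ 6 * X ^ 3) := by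
    refine hvolT.trans (hI6.trans ?_)
    calc (eLpNormLESNormFDerivOfEqInnerConst (volume : Measure (EuclideanSpace ℝ (Fin 3))) 2 : ℝ≥0∞) ^ 6 *
          ((2 * ∫⁻ y in ball (0 : EuclideanSpace ℝ (Fin 3)) (5 * L), ‖fderiv ℝ g y‖ₑ ^ 2) +
            2 * ENNReal.ofReal ((M / L) ^ 2) * ∫⁻ y in ball (0 : EuclideanSpace ℝ (Fin 3)) (5 * L), ‖g y‖ₑ ^ 2) ^ 3
        ≤ (eLpNormLESNormFDerivOfEqInnerConst (volume : Measure (EuclideanSpace ℝ (Fin 3))) 2 : ℝ≥0∞) ^ 6 *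
          (2 * ENNReal.ofReal (q * G) + 2 * ENNReal.ofReal m2 * ENNReal.ofReal N') ^ 3 := by gcongr
      _ = ENNReal.ofReal (Cr ^ 6 * X ^ 3) := by
          rw [← hofX, ← ENNReal.ofReal_pow hX0, hCr, ← ENNReal.ofReal_coe_nnreal, ← ENNReal.ofReal_pow (NNReal.coe_nonneg _),
            ← ENNReal.ofReal_mul (by positivity)]
  refine hmain.trans (ENNReal.ofReal_le_ofReal ?_)
  -- ### real bookkeeping: `X ≤ KX · L^{−1−ρ}`
  have e1 : A' = cA * 5 ^ (1 - 2 * ρ) * L ^ (1 - 2 * ρ) := by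
    rw [hA'def, Real.mul_rpow (by norm_num) hL0.le, mul_assoc]
  have e2 : E' = cE * 5 ^ (1 - ρ) * L ^ (1 - ρ) := by
    rw [hE'def, Real.mul_rpow (by norm_num) hL0.le, mul_assoc]
  have hL2 : L ^ 2 = L ^ (2 : ℝ) := (Real.rpow_two L).symm
  have hA'le : A' ≤ cA * 5 ^ (1 - 2 * ρ) * L ^ (3 - ρ) := by
    rw [e1]
    exact mul_le_mul_of_nonneg_left (Real.rpow_le_rpow_of_exponent_le hL1 (by linarith)) (by positivity)
  have hwE' : w * E' = K₂ ^ 2 * (cE * 5 ^ (1 - ρ)) * L ^ (3 - ρ) := by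
    have h23 : L ^ 2 * L ^ (1 - ρ) = L ^ (3 - ρ) := by
      rw [hL2, ← Real.rpow_add hL0]
      congr 1
      ring
    rw [hw, e2, mul_pow]
    calc K₂ ^ 2 * L ^ 2 * (cE * 5 ^ (1 - ρ) * L ^ (1 - ρ))
        = K₂ ^ 2 * (cE * 5 ^ (1 - ρ)) * (L ^ 2 * L ^ (1 - ρ)) := by ring
      _ = K₂ ^ 2 * (cE * 5 ^ (1 - ρ)) * L ^ (3 - ρ) := by rw [h23]
  have hGle : G ≤ G₁ * L ^ (3 - ρ) := by
    have hw2 : 2 * w * E' = 2 * (K₂ ^ 2 * (cE * 5 ^ (1 - ρ)) * L ^ (3 - ρ)) := by rw [mul_assoc, hwE']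
    calc G = 2 * (1 - γ) ^ 2 * A' + 2 * w * E' := hGdef
      _ ≤ 2 * (1 - γ) ^ 2 * (cA * 5 ^ (1 - 2 * ρ) * L ^ (3 - ρ)) + 2 * (K₂ ^ 2 * (cE * 5 ^ (1 - ρ)) * L ^ (3 - ρ)) := by
          rw [hw2]
          gcongr
      _ = G₁ * L ^ (3 - ρ) := by rw [hG₁]; ring
  have hqL : q * L ^ (3 - ρ) = κ ^ 2 / ε ^ 2 * L ^ (-1 - ρ) := by
    have hL4 : (L ^ 2) ^ 2 = L ^ (4 : ℝ) := by
      rw [hL2, ← Real.rpow_natCast, ← Real.rpow_mul hL0.le]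
      norm_num
    have hεL : ε ^ 2 * L ^ (4 : ℝ) ≠ 0 := by positivity
    have hsub : L ^ (3 - ρ) / L ^ (4 : ℝ) = L ^ (-1 - ρ) := by
      rw [← Real.rpow_sub hL0]
      ring_nf
    calc q * L ^ (3 - ρ) = κ ^ 2 / (ε ^ 2 * (L ^ 2) ^ 2) * L ^ (3 - ρ) := by
          rw [hq, hs]
          field_simp
      _ = κ ^ 2 / ε ^ 2 * (L ^ (3 - ρ) / L ^ (4 : ℝ)) := by
          rw [hL4]
          field_simp
      _ = κ ^ 2 / ε ^ 2 * L ^ (-1 - ρ) := by rw [hsub]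
  have hterm1 : 2 * (q * G) ≤ 2 * (κ ^ 2 / ε ^ 2 * G₁) * L ^ (-1 - ρ) := by
    calc 2 * (q * G) ≤ 2 * (q * (G₁ * L ^ (3 - ρ))) := by gcongr
      _ = 2 * G₁ * (q * L ^ (3 - ρ)) := by ring
      _ = 2 * G₁ * (κ ^ 2 / ε ^ 2 * L ^ (-1 - ρ)) := by rw [hqL]
      _ = 2 * (κ ^ 2 / ε ^ 2 * G₁) * L ^ (-1 - ρ) := by ring
  have e3 : (s / 4) ^ (3 / 2 : ℝ) = (ε / 4) ^ (3 / 2 : ℝ) * L ^ (3 : ℝ) := by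
    rw [hs, show ε * L ^ 2 / 4 = (ε / 4) * L ^ 2 by ring, Real.mul_rpow (by positivity) (by positivity), hL2,
      ← Real.rpow_mul hL0.le]
    norm_num
  have e4 : (5 * L) ^ (2 - 2 * ρ) = 5 ^ (2 - 2 * ρ) * L ^ (2 - 2 * ρ) := Real.mul_rpow (by norm_num) hL0.le
  have hε40 : (ε / 4) ^ (3 / 2 : ℝ) ≠ 0 := hε4.ne'
  have hL30 : L ^ (3 : ℝ) ≠ 0 := (Real.rpow_pos_of_pos hL0 _).ne'
  have hN'eq : N' = N₁ * L ^ (-(1 + 2 * ρ)) := by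
    have h12 : L ^ (2 - 2 * ρ) / L ^ (3 : ℝ) = L ^ (-(1 + 2 * ρ)) := by
      rw [← Real.rpow_sub hL0]
      ring_nf
    rw [hN', e3, e4, hN₁]
    calc (CD : ℝ) * (5 ^ (2 - 2 * ρ) * L ^ (2 - 2 * ρ)) / ((ε / 4) ^ (3 / 2 : ℝ) * L ^ (3 : ℝ))
        = (CD : ℝ) * 5 ^ (2 - 2 * ρ) * ((ε / 4) ^ (3 / 2 : ℝ))⁻¹ * (L ^ (2 - 2 * ρ) / L ^ (3 : ℝ)) := by
          field_simp
      _ = (CD : ℝ) * 5 ^ (2 - 2 * ρ) * ((ε / 4) ^ (3 / 2 : ℝ))⁻¹ * L ^ (-(1 + 2 * ρ)) := by rw [h12]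
  have hm2eq : m2 = M ^ 2 * L ^ (-2 : ℝ) := by
    rw [hm2, div_pow, Real.rpow_neg hL0.le, hL2, div_eq_mul_inv]
  have hm2N : m2 * N' = M ^ 2 * N₁ * L ^ (-3 - 2 * ρ) := by
    have h13 : L ^ (-2 : ℝ) * L ^ (-(1 + 2 * ρ)) = L ^ (-3 - 2 * ρ) := by
      rw [← Real.rpow_add hL0]
      ring_nf
    rw [hm2eq, hN'eq]
    calc M ^ 2 * L ^ (-2 : ℝ) * (N₁ * L ^ (-(1 + 2 * ρ))) = M ^ 2 * N₁ * (L ^ (-2 : ℝ) * L ^ (-(1 + 2 * ρ))) := by ring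
      _ = M ^ 2 * N₁ * L ^ (-3 - 2 * ρ) := by rw [h13]
  have hterm2 : 2 * m2 * N' ≤ 2 * (M ^ 2 * N₁) * L ^ (-1 - ρ) := by
    have hLe : L ^ (-3 - 2 * ρ) ≤ L ^ (-1 - ρ) := Real.rpow_le_rpow_of_exponent_le hL1 (by linarith)
    calc 2 * m2 * N' = 2 * (M ^ 2 * N₁) * L ^ (-3 - 2 * ρ) := by rw [mul_assoc, hm2N]; ring
      _ ≤ 2 * (M ^ 2 * N₁) * L ^ (-1 - ρ) := mul_le_mul_of_nonneg_left hLe (by positivity)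
  have hXK : X ≤ KX * L ^ (-1 - ρ) := by
    calc X = 2 * (q * G) + 2 * m2 * N' := hX
      _ ≤ 2 * (κ ^ 2 / ε ^ 2 * G₁) * L ^ (-1 - ρ) + 2 * (M ^ 2 * N₁) * L ^ (-1 - ρ) := add_le_add hterm1 hterm2
      _ = KX * L ^ (-1 - ρ) := by rw [hKX]; ring
  have hp3 : (L ^ (-1 - ρ)) ^ 3 = L ^ (-3 - 3 * ρ) := by
    rw [← Real.rpow_natCast, ← Real.rpow_mul hL0.le]
    norm_num
    ring_nf
  calc Cr ^ 6 * X ^ 3 ≤ Cr ^ 6 * (KX * L ^ (-1 - ρ)) ^ 3 := by gcongr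
    _ = Cr ^ 6 * KX ^ 3 * L ^ (-3 - 3 * ρ) := by rw [mul_pow, hp3]; ring

/-- **THE PRESSURE-HIGH SET IS SOBOLEV-THIN FAR OUT — growth-form data**: under the hypotheses of `Loc.volume_pressureHigh_inter_shell_le_sobolev_of_growth`
and `ρ > −1` there are `K′ ≥ 0`, `L₀ ≥ max 1 L₁` with `vol({ε‖y‖² < P y} ∩ {R ≤ ‖y‖}) ≤ K′ R^{−3−3ρ}` for all `R ≥ L₀` (dyadic tail
`Loc.volume_inter_far_le_of_shell`). [folklore; Gagliardo–Nirenberg–Sobolev inequality] -/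
theorem volume_pressureHigh_inter_far_le_sobolev_of_growth {ρ : ℝ} (hρ0 : -1 < ρ)
    (hprof : IsSelfSimilarEulerProfile γ 0 U P)
    {K₁ : ℝ} (hK₁ : ∀ y : EuclideanSpace ℝ (Fin 3), ‖U y‖ ≤ K₁ * (1 + ‖y‖))
    {cA cE : ℝ} (hcA : 0 ≤ cA) (hcE : 0 ≤ cE)
    (hA : ∀ L : ℝ, 0 < L → ∫⁻ y in ball (0 : EuclideanSpace ℝ (Fin 3)) L, ‖U y‖ₑ ^ 2 ≤ ENNReal.ofReal (cA * L ^ (1 - 2 * ρ)))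
    (hE : ∀ L : ℝ, 0 < L → ∫⁻ y in ball (0 : EuclideanSpace ℝ (Fin 3)) L, ‖fderiv ℝ U y‖ₑ ^ 2 ≤
      ENNReal.ofReal (cE * L ^ (1 - ρ)))
    {Q : EuclideanSpace ℝ (Fin 3) → ℝ} (hQm : AEStronglyMeasurable Q volume) {CD : ℝ≥0} {L₁ : ℝ}
    (hD : ∀ R : ℝ, L₁ ≤ R → ∫⁻ y in ball (0 : EuclideanSpace ℝ (Fin 3)) R, ‖Q y‖ₑ ^ (3 / 2 : ℝ) ≤
      CD * ENNReal.ofReal (R ^ (2 - 2 * ρ)))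
    {c₀ : ℝ} (hc₀ : Q =ᵐ[volume] fun y => P y + c₀) {ε : ℝ} (hε : 0 < ε) :
    ∃ K' L₀ : ℝ, 0 ≤ K' ∧ max 1 L₁ ≤ L₀ ∧ ∀ R : ℝ, L₀ ≤ R →
      volume ({y : EuclideanSpace ℝ (Fin 3) | ε * ‖y‖ ^ 2 < P y} ∩ {y | R ≤ ‖y‖}) ≤
        ENNReal.ofReal (K' * R ^ (-3 - 3 * ρ)) := by
  obtain ⟨K, L₀, hK0, hL₀, hshell⟩ :=
    volume_pressureHigh_inter_shell_le_sobolev_of_growth (by linarith) hprof hK₁ hcA hcE hA hE hQm hD hc₀ hε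
  have hs : (-3 - 3 * ρ : ℝ) < 0 := by linarith
  have hL₀1 : 1 ≤ L₀ := (le_max_left _ _).trans hL₀
  refine ⟨|K| * (1 - (2 : ℝ) ^ (-3 - 3 * ρ))⁻¹, L₀, ?_, hL₀, fun R hR =>
    volume_inter_far_le_of_shell _ (one_pos.trans_le hL₀1) hs hshell hR⟩
  have h2s1 : (2 : ℝ) ^ (-3 - 3 * ρ) < 1 := Real.rpow_lt_one_of_one_lt_of_neg (by norm_num) hs
  have : 0 < (1 - (2 : ℝ) ^ (-3 - 3 * ρ))⁻¹ := inv_pos.2 (by linarith)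
  positivity
end Summit.NavierStokesRegularity.NavierStokesRegularity.Theorems.PowerGaugeEulerLiouville.Loc

end
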